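import Summits.Ventures.HSemireg.WedgeHankelRecurrenceGaussMaxMass

/-!
# Venture HSemireg — **THE RESOLVENT OF THE JACOBI MATRIX IS THE STIELTJES TRANSFORM OF THE GAUSS RULE**: for the recurrence `(a, b, q)` with second-kind polynomials `r` (`r_0 = 0`, `r_1 = 1`,
# same recurrence), the trailing submatrix `J_t[1.., 1..]` is the Jacobi matrix of the shifted coefficients, so `det(z − J_t[1..,1..]) = r_{t+1}(z)` (the associated polynomial); hence for
# `q_{t+1}(z) ≠ 0`, `((z − J_t)⁻¹)_{00} = r_{t+1}(z) ∕ q_{t+1}(z) = Σ_k λ_k ∕ (z − z_k)` with the Favard weights `λ_k = b_1⋯b_t ∕ (q_{t+1}′(z_k) q_t(z_k))` on the eigenvalues `z_k` (N284)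

HONEST FRAMING. Part of the Lean index of the computation cell `pub-hsemireg` (seat p10 gen 43, Sunday typer «UNIFORM-IN-n»).  Square real matrices (adjugate, inverse, determinants) and real
polynomials only; no variety, no cohomology theory, no sheaf, no Ext group and no semiregularity map is constructed here; nothing here says that HC / HC_CM / HC_AV holds; no Literature fact
(unproved `Prop`) is declared or used.  Custodian versions as in `WedgeHankelSiegelIdeal` (1/3).
SOURCES (cited).  T. J. Stieltjes, *Recherches sur les fractions continues* (1894), §§ 1–8 (the `n`-th convergent `r_n ∕ q_n` of the J-fraction); G. H. Golub, J. H. Welsch, Math. Comp. 23 (1969)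
§2; W. Gautschi, *Orthogonal Polynomials: Computation and Approximation* (2004), §1.4 (associated polynomials, `((zI − J_n)^{-1})_{11} = σ_n(z) ∕ π_n(z)`); N. I. Akhiezer, *The Classical Moment
Problem*, Ch. I §2 and §4 (polynomials of the second kind, resolvent of the J-matrix); T. S. Chihara, *An Introduction to Orthogonal Polynomials* (1978), Ch. III §4 (numerator polynomials).
PROOF TYPED HERE.  `J_t[1..,1..]` satisfies the Jacobi hypothesis for `(a_{k+1}, b_{k+1})`, whose recurrence is solved by `k ↦ r_{k+1}`, so N293 `det_scalar_sub_jacobi` gives `det(z − J_t[1..,1..]) =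
r_{t+1}(z)`; `(A⁻¹)_{00} = adj(A)_{00} ∕ det A` with `adj(A)_{00} = det A[1..,1..]` (Mathlib `adjugate_fin_succ_eq_det_submatrix`); the partial fractions are N284 `sum_weight_div_sub_eq_secondKind_div`.
DEDUP DISCLOSURE (`rg -n 'resolvent|inv_scalar_sub_jacobi|associated_poly|jacobi_submatrix_succ' Summits/Ventures/HSemireg`, 2026-09-03): N284 (`GaussStieltjesPade`) is the partial-fraction ∕ Padé
identity for the second-kind polynomials; the matrix resolvent is new.  The 4 names below: 0 hits tree-wide.

WHAT IS IN THE TREE.  N293 `det_scalar_sub_jacobi`; N284 `sum_weight_div_sub_eq_secondKind_div`; N279 `recurrence_zeros`; Mathlib `Matrix.inv_def`, `Ring.inverse_eq_inv'`,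
`Matrix.adjugate_fin_succ_eq_det_submatrix`, `Fin.succAbove_zero`, `Matrix.submatrix_sub`, `Matrix.scalar_apply`.
THIS FILE (namespace `Summit.Ventures.HSemireg.Wedge.HankelOuter` continued; CHAINED on N309 (import), N284, N293; 0 definitions):
* §1075 `jacobi_submatrix_succ` (`J_t[1..,1..]` is the Jacobi matrix of `(a_{k+1}, b_{k+1})`), **`det_scalar_sub_jacobi_submatrix_succ`** (`det(z − J_t[1..,1..]) = r_{t+1}(z)`, the associated
  polynomial), **`inv_scalar_sub_jacobi_zero_zero`** (`((z − J_t)⁻¹)_{00} = r_{t+1}(z) ∕ q_{t+1}(z)`, every real `z`), **`inv_scalar_sub_jacobi_zero_zero_eq_sum`** (STIELTJES ∕ GOLUB–WELSCH: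
  `= Σ_k λ_k ∕ (z − z_k)` with the Favard weights on the eigenvalues, `b > 0`).
CAVEATS.  Favard normalisation (total mass `1`); for a general positive measure multiply by `h_0 = Σ ν` (N299 ∕ N308).  Nothing Ext-side.  New names only.
-/

open Module Polynomial
open scoped Matrix Polynomial

namespace Summit.Ventures.HSemireg.Wedge.HankelOuter

/-! ## §1075. `((z − J_t)⁻¹)_{00} = r_{t+1}(z) ∕ q_{t+1}(z) = Σ_k λ_k ∕ (z − z_k)` -/

/-- **The trailing principal submatrix of the Jacobi matrix is the Jacobi matrix of the shifted coefficients.** [mechanism; Gautschi §1.4; this file, §1075] -/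
theorem jacobi_submatrix_succ {a b : ℕ → ℝ} {t : ℕ} {J : Matrix (Fin (t + 2)) (Fin (t + 2)) ℝ}
    (hJ : ∀ i j : Fin (t + 2), J i j = if (i : ℕ) = j then a i else if (j : ℕ) = i + 1 then 1 else if (i : ℕ) = j + 1 then b i else 0) (i j : Fin (t + 1)) :
    (J.submatrix Fin.succ Fin.succ) i j = if (i : ℕ) = j then a (i + 1) else if (j : ℕ) = i + 1 then 1 else if (i : ℕ) = j + 1 then b (i + 1) else 0 := by
  rw [Matrix.submatrix_apply, hJ]
  simp only [Fin.val_succ, Nat.add_right_cancel_iff]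

/-- **`det(z − J_t[1..,1..]) = r_{t+1}(z)`**: the characteristic polynomial of the trailing submatrix is the ASSOCIATED (second-kind) polynomial (`r_0 = 0`, `r_1 = 1`, same recurrence).
[Stieltjes 1894; Gautschi §1.4; Akhiezer I §2; this file, §1075] -/
theorem det_scalar_sub_jacobi_submatrix_succ {r : ℕ → ℝ[X]} {a b : ℕ → ℝ} (hr0 : r 0 = 0) (hr1 : r 1 = 1)
    (hrrec : ∀ n, r (n + 2) = (Polynomial.X - C (a (n + 1))) * r (n + 1) - C (b (n + 1)) * r n) {t : ℕ} {J : Matrix (Fin (t + 2)) (Fin (t + 2)) ℝ}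
    (hJ : ∀ i j : Fin (t + 2), J i j = if (i : ℕ) = j then a i else if (j : ℕ) = i + 1 then 1 else if (i : ℕ) = j + 1 then b i else 0) (z : ℝ) :
    (Matrix.scalar (Fin (t + 1)) z - J.submatrix Fin.succ Fin.succ).det = (r (t + 2)).eval z := by
  -- `k ↦ r (k + 1)` solves the shifted recurrence
  have hq0 : r (0 + 1) = 1 := hr1
  have hq1 : r (1 + 1) = Polynomial.X - C (a (0 + 1)) := by
    have h := hrrec 0
    rw [hr0, mul_zero, sub_zero, hr1, mul_one] at h
    exact h
  have hrec' : ∀ n, r (n + 2 + 1) = (Polynomial.X - C (a (n + 1 + 1))) * r (n + 1 + 1) - C (b (n + 1 + 1)) * r (n + 1) := fun n => hrrec (n + 1)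
  exact det_scalar_sub_jacobi (q := fun k => r (k + 1)) (a := fun k => a (k + 1)) (b := fun k => b (k + 1)) hq0 hq1 hrec' (jacobi_submatrix_succ hJ) z

/-- **`((z − J_t)⁻¹)_{00} = r_{t+1}(z) ∕ q_{t+1}(z)`** (Cramer: the `(0,0)` cofactor is `det(z − J_t[1..,1..])`; at an eigenvalue both sides are `0` by the conventions `0⁻¹ = 0`, `x ∕ 0 = 0`). [Stieltjes 1894; Gautschi §1.4; Akhiezer I §4; this file, §1075] -/
theorem inv_scalar_sub_jacobi_zero_zero {q r : ℕ → ℝ[X]} {a b : ℕ → ℝ} (hq0 : q 0 = 1) (hq1 : q 1 = Polynomial.X - C (a 0))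
    (hrec : ∀ n, q (n + 2) = (Polynomial.X - C (a (n + 1))) * q (n + 1) - C (b (n + 1)) * q n) (hr0 : r 0 = 0) (hr1 : r 1 = 1)
    (hrrec : ∀ n, r (n + 2) = (Polynomial.X - C (a (n + 1))) * r (n + 1) - C (b (n + 1)) * r n) {t : ℕ} {J : Matrix (Fin (t + 2)) (Fin (t + 2)) ℝ}
    (hJ : ∀ i j : Fin (t + 2), J i j = if (i : ℕ) = j then a i else if (j : ℕ) = i + 1 then 1 else if (i : ℕ) = j + 1 then b i else 0) (z : ℝ) :
    (Matrix.scalar (Fin (t + 2)) z - J)⁻¹ 0 0 = (r (t + 2)).eval z / (q (t + 2)).eval z := by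
  have hdet : (Matrix.scalar (Fin (t + 2)) z - J).det = (q (t + 2)).eval z := det_scalar_sub_jacobi hq0 hq1 hrec hJ z
  have hsub : (Matrix.scalar (Fin (t + 2)) z - J).submatrix Fin.succ Fin.succ = Matrix.scalar (Fin (t + 1)) z - J.submatrix Fin.succ Fin.succ := by
    ext i j
    simp only [Matrix.submatrix_apply, Matrix.sub_apply, Matrix.scalar_apply, Matrix.diagonal_apply, Fin.succ_inj]
  rw [Matrix.inv_def, Ring.inverse_eq_inv', Matrix.smul_apply, smul_eq_mul, Matrix.adjugate_fin_succ_eq_det_submatrix, Fin.succAbove_zero, hsub,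
    det_scalar_sub_jacobi_submatrix_succ hr0 hr1 hrrec hJ z, hdet]
  simp only [Fin.val_zero, add_zero, pow_zero, one_mul]
  rw [inv_mul_eq_div]

/-- **STIELTJES ∕ GOLUB–WELSCH: `((z − J_t)⁻¹)_{00} = Σ_k λ_k ∕ (z − z_k)`** — the `(0,0)` entry of the resolvent of the Jacobi matrix is the Stieltjes transform of the Gauss (Favard) rule on its
eigenvalues `z_0 < ⋯ < z_{t+1}`, with weights `λ_k = b_1⋯b_{t+1} ∕ (q_{t+2}′(z_k) q_{t+1}(z_k))` (`b > 0`, `q_{t+2}(z) ≠ 0`). [Stieltjes 1894; Golub–Welsch 1969; Gautschi §1.4; this file, §1075] -/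
theorem inv_scalar_sub_jacobi_zero_zero_eq_sum {q r : ℕ → ℝ[X]} {a b : ℕ → ℝ} (hq0 : q 0 = 1) (hq1 : q 1 = Polynomial.X - C (a 0))
    (hrec : ∀ n, q (n + 2) = (Polynomial.X - C (a (n + 1))) * q (n + 1) - C (b (n + 1)) * q n) (hr0 : r 0 = 0) (hr1 : r 1 = 1)
    (hrrec : ∀ n, r (n + 2) = (Polynomial.X - C (a (n + 1))) * r (n + 1) - C (b (n + 1)) * r n) (hb : ∀ j, 0 < b j) {t : ℕ} {J : Matrix (Fin (t + 2)) (Fin (t + 2)) ℝ}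
    (hJ : ∀ i j : Fin (t + 2), J i j = if (i : ℕ) = j then a i else if (j : ℕ) = i + 1 then 1 else if (i : ℕ) = j + 1 then b i else 0) {z : ℝ} (hz : (q (t + 2)).eval z ≠ 0) :
    ∃ y : Fin (t + 2) → ℝ, StrictMono y ∧ (∀ k, (q (t + 2)).eval (y k) = 0) ∧
      (Matrix.scalar (Fin (t + 2)) z - J)⁻¹ 0 0 = ∑ k, (∏ l ∈ Finset.Ico 1 (t + 2), b l) / ((derivative (q (t + 2))).eval (y k) * (q (t + 1)).eval (y k)) / (z - y k) := by
  obtain ⟨y, hy, hyr, -⟩ := recurrence_zeros hq0 hq1 hrec hb (t + 1)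
  refine ⟨y, hy, hyr, ?_⟩
  rw [inv_scalar_sub_jacobi_zero_zero hq0 hq1 hrec hr0 hr1 hrrec hJ z, sum_weight_div_sub_eq_secondKind_div hq0 hq1 hrec hr0 hr1 hrrec hb hy hyr hz]

end Summit.Ventures.HSemireg.Wedge.HankelOuter
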